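import Literature.MathematicalPhysics.KineticTheory.InfiniteChainDynamics
import HarnessLib

/-!
# Partial momentum reversal: static current covariances of a DLR state vanish beyond nearest neighbours

Topic `Literature/MathematicalPhysics/KineticTheory`; proofs-only companion of
`InfiniteChainDynamics.lean` (no named fact, no `Prop`-valued definition; ONE auxiliary map `momentumReversalOn`, the finite-set
analogue of the tree's global `momentumReversalZ` of `InfiniteChainObservables.lean`).

Lanford–Lebowitz–Lieb (J. Stat. Phys. **16** (1977), §4 remark (ii)): "with respect to any Gibbs
state, the `p_i` are independent, identically distributed, Gaussian random variables of mean
zero". The symmetry content of this remark is that EVERY DLR state `μ` of the chain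
`P : OscillatorChain` (`IsChainGibbsMeasure P T μ`, any `T`, any `P`) is invariant under the
reversal of the momenta of ANY FINITE SET of sites, `R_S : p_x ↦ -p_x (x ∈ S)`: the finite-volume
Gibbs kernel `γ_S(· | η)` has a density even in each `p_x`, `x ∈ S`, with respect to an a priori
measure that `R_S` preserves, and its boundary condition enters only off `S`; the DLR equation in
the volume `S` transports this to `μ` (set by set, so no measurability of the kernel in the
boundary condition is needed).

Consequences for the Green–Kubo objects of `InfiniteChainDynamics.lean` (bond current
`j_x = -½ (p_x + p_{x+1}) V'(q_{x+1} - q_x)`, `bondCurrentZ`):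
* `integral_bondCurrentZ_eq_zero`: `∫ j_x dμ = 0` for every DLR state (`j_x` is odd under
  `R_{{x, x+1}}`; no integrability needed, Bochner junk being `0` on both sides);
* `integral_bondCurrentZ_mul_eq_zero`: `∫ j_y j_x dμ = 0` whenever `2 ≤ |x - y|` (`j_y j_x` is odd
  under `R_{{y, y+1}}`), for EVERY DLR state — tempered or not, shift-invariant or not;
* hence the static summed covariance `∑_x |∫ j_0 j_x dμ|` is a sum of THREE terms and is always
  finite (`summable_abs_integral_bondCurrentZ_mul`, `tsum_integral_bondCurrentZ_mul`), and for any
  dynamics `D` preserving `μ` the time-zero clause of the Abelian Green–Kubo witness predicate,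
  `D.HasAbsConvergentCorrelation μ 0`, is equivalent to the sitewise integrability of the
  products `j_0 j_x` (`hasAbsConvergentCorrelation_zero_iff`), and
  `D.currentCorrelation μ 0 = ∫ j_0 j_{-1} + ∫ j_0² + ∫ j_0 j_1` (`currentCorrelation_zero_eq`).
In particular the `t = 0` clause carries NO information on the spatial growth of the state (it does
not bound `∫ j_x² dμ` uniformly in `x`): recorded for the witness-regularisation analysis of
`Summit.AtomisticToContinuum.FouriersLaw` (crux `GreenKuboContinuation`).
-/

noncomputable section

open MeasureTheory Filter Set Literature.Probability.LatticeModels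
open scoped ENNReal

namespace Literature.MathematicalPhysics.KineticTheory.HeatConduction

/-! ### The partial momentum reversal `R_S` -/

/-- Reversal of the momenta at the sites of the finite set `S`: `(R_S σ)_x = (q_x, -p_x)` for
`x ∈ S`, `= σ_x` otherwise. [folklore] -/
def momentumReversalOn (S : Finset ℤ) (σ : ChainConfig) : ChainConfig :=
  fun x => if x ∈ S then ((σ x).1, -(σ x).2) else σ x

/-- [folklore] -/
theorem momentumReversalOn_apply_mem {S : Finset ℤ} (σ : ChainConfig) {x : ℤ} (hx : x ∈ S) :
    momentumReversalOn S σ x = ((σ x).1, -(σ x).2) := by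
  simp [momentumReversalOn, hx]

/-- [folklore] -/
theorem momentumReversalOn_apply_not_mem {S : Finset ℤ} (σ : ChainConfig) {x : ℤ} (hx : x ∉ S) :
    momentumReversalOn S σ x = σ x := by
  simp [momentumReversalOn, hx]

/-- `R_S` does not move positions. [folklore] -/
@[simp] theorem momentumReversalOn_fst (S : Finset ℤ) (σ : ChainConfig) (x : ℤ) :
    (momentumReversalOn S σ x).1 = (σ x).1 := by
  by_cases hx : x ∈ S <;> simp [momentumReversalOn, hx]

/-- `R_S` does not change squared momenta. [folklore] -/
@[simp] theorem momentumReversalOn_snd_sq (S : Finset ℤ) (σ : ChainConfig) (x : ℤ) :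
    (momentumReversalOn S σ x).2 ^ 2 = (σ x).2 ^ 2 := by
  by_cases hx : x ∈ S <;> simp [momentumReversalOn, hx]

/-- Momenta inside `S` are reversed. [folklore] -/
theorem momentumReversalOn_snd_mem {S : Finset ℤ} (σ : ChainConfig) {x : ℤ} (hx : x ∈ S) :
    (momentumReversalOn S σ x).2 = -(σ x).2 := by
  simp [momentumReversalOn, hx]

/-- Momenta outside `S` are unchanged. [folklore] -/
theorem momentumReversalOn_snd_not_mem {S : Finset ℤ} (σ : ChainConfig) {x : ℤ} (hx : x ∉ S) :
    (momentumReversalOn S σ x).2 = (σ x).2 := by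
  simp [momentumReversalOn, hx]

/-- `R_S` is an involution. [folklore] -/
@[simp] theorem momentumReversalOn_momentumReversalOn (S : Finset ℤ) (σ : ChainConfig) :
    momentumReversalOn S (momentumReversalOn S σ) = σ := by
  funext x
  by_cases hx : x ∈ S <;> simp [momentumReversalOn, hx]

/-- `R_S` is measurable. [folklore] -/
theorem measurable_momentumReversalOn (S : Finset ℤ) : Measurable (momentumReversalOn S) := by
  refine measurable_pi_lambda _ fun x => ?_
  by_cases hx : x ∈ S
  · simp only [momentumReversalOn, hx, if_true]
    exact (measurable_pi_apply x).fst.prodMk (measurable_pi_apply x).snd.neg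
  · simp only [momentumReversalOn, hx, if_false]
    exact measurable_pi_apply x

/-- `R_S` is (the coercion of) a measurable equivalence of the phase space, its own inverse
(stated existentially: no bundled definition is introduced). [folklore] -/
theorem exists_measurableEquiv_momentumReversalOn (S : Finset ℤ) :
    ∃ e : ChainConfig ≃ᵐ ChainConfig, ⇑e = momentumReversalOn S :=
  ⟨{ toFun := momentumReversalOn S,
      invFun := momentumReversalOn S,
      left_inv := fun σ => momentumReversalOn_momentumReversalOn S σ,
      right_inv := fun σ => momentumReversalOn_momentumReversalOn S σ,
      measurable_toFun := measurable_momentumReversalOn S,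
      measurable_invFun := measurable_momentumReversalOn S }, rfl⟩

/-- Change of variables along `R_S` for Bochner integrals (no integrability needed: `R_S` is a
measurable equivalence). [folklore] -/
theorem integral_comp_momentumReversalOn (S : Finset ℤ) (μ : Measure ChainConfig)
    (f : ChainConfig → ℝ) :
    ∫ σ, f (momentumReversalOn S σ) ∂μ = ∫ σ, f σ ∂(μ.map (momentumReversalOn S)) := by
  obtain ⟨e, he⟩ := exists_measurableEquiv_momentumReversalOn S
  rw [← he, integral_map_equiv]

/-- Change of variables along `R_S` for lower Lebesgue integrals (no measurability needed). [folklore] -/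
theorem lintegral_comp_momentumReversalOn (S : Finset ℤ) (μ : Measure ChainConfig)
    (f : ChainConfig → ℝ≥0∞) :
    ∫⁻ σ, f (momentumReversalOn S σ) ∂μ = ∫⁻ σ, f σ ∂(μ.map (momentumReversalOn S)) := by
  obtain ⟨e, he⟩ := exists_measurableEquiv_momentumReversalOn S
  rw [← he, lintegral_map_equiv]

/-- Restriction commutes with the push-forward along `R_S`. [folklore] -/
theorem restrict_map_momentumReversalOn (S : Finset ℤ) (μ : Measure ChainConfig)
    {s : Set ChainConfig} (hs : MeasurableSet s) :
    (μ.map (momentumReversalOn S)).restrict s =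
      (μ.restrict (momentumReversalOn S ⁻¹' s)).map (momentumReversalOn S) :=
  Measure.restrict_map (measurable_momentumReversalOn S) hs

/-- **Odd observables of an `R_S`-invariant measure integrate to zero** (both sides are Bochner
junk `0` if `f` is not integrable). [folklore] -/
theorem integral_eq_zero_of_momentumReversalOn_odd {S : Finset ℤ} {μ : Measure ChainConfig}
    (hμ : μ.map (momentumReversalOn S) = μ) {f : ChainConfig → ℝ}
    (hf : ∀ σ, f (momentumReversalOn S σ) = -f σ) : ∫ σ, f σ ∂μ = 0 := by
  have h := integral_comp_momentumReversalOn S μ f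
  rw [hμ] at h
  simp only [hf, integral_neg] at h
  linarith

/-- Integrability is invariant under `R_S` for an `R_S`-invariant measure. [folklore] -/
theorem integrable_comp_momentumReversalOn_iff {S : Finset ℤ} {μ : Measure ChainConfig}
    (hμ : μ.map (momentumReversalOn S) = μ) (f : ChainConfig → ℝ) :
    Integrable (fun σ => f (momentumReversalOn S σ)) μ ↔ Integrable f μ := by
  obtain ⟨e, he⟩ := exists_measurableEquiv_momentumReversalOn S
  have h := integrable_map_equiv e f (μ := μ)
  rw [he, hμ] at h
  exact h.symm

/-! ### The chain's potential, Hamiltonians and Gibbs kernels under `R_S` -/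

namespace OscillatorChain

variable (P : OscillatorChain)

/-- The chain potential is even in every momentum. [folklore] -/
@[simp] theorem chainPotential_momentumReversalOn (S : Finset ℤ) (A : Finset ℤ) (σ : ChainConfig) :
    P.chainPotential A (momentumReversalOn S σ) = P.chainPotential A σ := by
  simp [OscillatorChain.chainPotential]

/-- The finite-volume Hamiltonians are even in every momentum. [folklore] -/
@[simp] theorem hamiltonianIn_chainPotential_momentumReversalOn (S Λ : Finset ℤ) (σ : ChainConfig) :
    hamiltonianIn P.chainPotential chainSupp Λ (momentumReversalOn S σ) =
      hamiltonianIn P.chainPotential chainSupp Λ σ := by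
  unfold hamiltonianIn
  exact Finset.sum_congr rfl fun A _ => P.chainPotential_momentumReversalOn S A σ

/-- The bond current `j_x` is ODD under `R_S` when both of its momenta are reversed. [folklore] -/
theorem bondCurrentZ_momentumReversalOn_of_mem {S : Finset ℤ} (σ : ChainConfig) {x : ℤ}
    (hx : x ∈ S) (hx1 : x + 1 ∈ S) :
    P.bondCurrentZ (momentumReversalOn S σ) x = -P.bondCurrentZ σ x := by
  simp only [OscillatorChain.bondCurrentZ, momentumReversalOn_fst, momentumReversalOn_snd_mem σ hx,
    momentumReversalOn_snd_mem σ hx1]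
  ring

/-- The bond current `j_x` is EVEN under `R_S` when none of its momenta is reversed. [folklore] -/
theorem bondCurrentZ_momentumReversalOn_of_not_mem {S : Finset ℤ} (σ : ChainConfig) {x : ℤ}
    (hx : x ∉ S) (hx1 : x + 1 ∉ S) :
    P.bondCurrentZ (momentumReversalOn S σ) x = P.bondCurrentZ σ x := by
  simp only [OscillatorChain.bondCurrentZ, momentumReversalOn_fst,
    momentumReversalOn_snd_not_mem σ hx, momentumReversalOn_snd_not_mem σ hx1]

end OscillatorChain

/-- Tilting by an `R_S`-even density commutes with `R_S`:
`(μ.tilted f) ∘ R_S⁻¹ = (μ ∘ R_S⁻¹).tilted f` when `f ∘ R_S = f` (change of variables along the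
measurable equivalence; no measurability of `f` needed). [folklore] -/
theorem map_tilted_momentumReversalOn (S : Finset ℤ) (μ : Measure ChainConfig) (f : ChainConfig → ℝ)
    (hf : ∀ σ, f (momentumReversalOn S σ) = f σ) :
    (μ.tilted f).map (momentumReversalOn S) = (μ.map (momentumReversalOn S)).tilted f := by
  -- adapted from `map_tilted_momentumReversalZ` (InfiniteChainObservables)
  ext s hs
  rw [Measure.map_apply (measurable_momentumReversalOn S) hs,
    tilted_apply' _ _ (measurable_momentumReversalOn S hs), tilted_apply' _ _ hs,
    ← integral_comp_momentumReversalOn, restrict_map_momentumReversalOn S μ hs,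
    ← lintegral_comp_momentumReversalOn]
  simp only [hf]

/-- `R_S` acts on glued configurations by reversing the inside (the box reversal
`ζ ↦ (i ↦ (ζ_i.1, -ζ_i.2) if i ∈ S, ζ_i otherwise)`) and the boundary condition separately. [folklore] -/
theorem momentumReversalOn_glueWith (S Λ : Finset ℤ) (ζ : Λ → ℝ × ℝ) (η : ChainConfig) :
    momentumReversalOn S (glueWith Λ ζ η) =
      glueWith Λ (fun i : Λ => if (i : ℤ) ∈ S then ((ζ i).1, -(ζ i).2) else ζ i)
        (momentumReversalOn S η) := by
  funext x
  by_cases hx : x ∈ Λ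
  · by_cases hxS : x ∈ S
    · simp [glueWith_apply_mem _ _ _ hx, momentumReversalOn, hxS]
    · simp [glueWith_apply_mem _ _ _ hx, momentumReversalOn, hxS]
  · by_cases hxS : x ∈ S
    · simp [glueWith_apply_not_mem _ _ _ hx, momentumReversalOn, hxS]
    · simp [glueWith_apply_not_mem _ _ _ hx, momentumReversalOn, hxS]

/-- If `S ⊆ Λ`, the boundary condition `R_S η` glues like `η` (only `η` off `Λ` enters). [folklore] -/
theorem glueWith_momentumReversalOn_of_subset {S Λ : Finset ℤ} (h : S ⊆ Λ) (ζ : Λ → ℝ × ℝ)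
    (η : ChainConfig) : glueWith Λ ζ (momentumReversalOn S η) = glueWith Λ ζ η := by
  funext x
  by_cases hx : x ∈ Λ
  · simp [glueWith_apply_mem _ _ _ hx]
  · have hxS : x ∉ S := fun hxS => hx (h hxS)
    simp [glueWith_apply_not_mem _ _ _ hx, momentumReversalOn_apply_not_mem η hxS]

/-- The box reversal preserves the product Lebesgue measure. [folklore] -/
theorem measurePreserving_boxReversalOn (S Λ : Finset ℤ) :
    MeasurePreserving (fun (ζ : Λ → ℝ × ℝ) (i : Λ) => if (i : ℤ) ∈ S then ((ζ i).1, -(ζ i).2) else ζ i)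
      (Measure.pi fun _ : Λ => (volume : Measure (ℝ × ℝ))) (Measure.pi fun _ => volume) := by
  -- adapted from `measurePreserving_boxReversal` (InfiniteChainObservables)
  have hneg : MeasurePreserving (Neg.neg : ℝ → ℝ) volume volume := by
    refine ⟨measurable_neg, ?_⟩
    have h := Real.map_volume_mul_left (a := (-1 : ℝ)) (by norm_num)
    have hfun : (fun x : ℝ => -1 * x) = Neg.neg := funext fun x => neg_one_mul x
    rw [hfun] at h
    rw [h]
    simp
  have h1 : MeasurePreserving (Prod.map id Neg.neg : ℝ × ℝ → ℝ × ℝ) volume volume :=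
    (MeasurePreserving.id (volume : Measure ℝ)).prod hneg
  set f : Λ → (ℝ × ℝ → ℝ × ℝ) := fun i => if (i : ℤ) ∈ S then Prod.map id Neg.neg else id with hf
  have hfi : ∀ i : Λ, MeasurePreserving (f i) (volume : Measure (ℝ × ℝ)) volume := by
    intro i
    by_cases hi : (i : ℤ) ∈ S
    · simp only [hf, hi, if_true]; exact h1
    · simp only [hf, hi, if_false]; exact MeasurePreserving.id _
  have hpi := measurePreserving_pi (fun _ : Λ => (volume : Measure (ℝ × ℝ))) (fun _ => volume) hfi
  have heq : (fun (ζ : Λ → ℝ × ℝ) (i : Λ) => f i (ζ i)) =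
      fun (ζ : Λ → ℝ × ℝ) (i : Λ) => if (i : ℤ) ∈ S then ((ζ i).1, -(ζ i).2) else ζ i := by
    funext ζ i
    by_cases hi : (i : ℤ) ∈ S
    · simp [hf, hi, Prod.map]
    · simp [hf, hi]
  rwa [heq] at hpi

namespace OscillatorChain

variable (P : OscillatorChain)

/-- **Equivariance of the finite-volume Gibbs distributions under `R_S`**:
`γ_Λ(· | R_S η) = γ_Λ(· | η) ∘ R_S⁻¹` (`H_Λ ∘ R_S = H_Λ`, `R_S` preserves `∏ dq dp`). [folklore] -/
theorem chainSpecification_momentumReversalOn (S : Finset ℤ) (T : ℝ) (Λ : Finset ℤ)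
    (η : ChainConfig) :
    P.chainSpecification T Λ (momentumReversalOn S η) =
      (P.chainSpecification T Λ η).map (momentumReversalOn S) := by
  -- adapted from `chainSpecification_momentumReversalZ` (InfiniteChainObservables)
  simp only [OscillatorChain.chainSpecification, gibbsSpecOfPotential]
  rw [map_tilted_momentumReversalOn S _ _ (fun σ => by
    simp only [hamiltonianIn_chainPotential_momentumReversalOn])]
  congr 1
  rw [Measure.map_map (measurable_momentumReversalOn S) (measurable_glueWith Λ η)]
  have hcomp : ((momentumReversalOn S) ∘ fun ζ : Λ → ℝ × ℝ => glueWith Λ ζ η) =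
      (fun ζ : Λ → ℝ × ℝ => glueWith Λ ζ (momentumReversalOn S η)) ∘
        fun (ζ : Λ → ℝ × ℝ) (i : Λ) => if (i : ℤ) ∈ S then ((ζ i).1, -(ζ i).2) else ζ i := by
    funext ζ
    exact momentumReversalOn_glueWith S Λ ζ η
  rw [hcomp, ← Measure.map_map (measurable_glueWith Λ _) (measurePreserving_boxReversalOn S Λ).measurable,
    (measurePreserving_boxReversalOn S Λ).map_eq]

/-- For `S ⊆ Λ` the kernel does not see the reversal of the boundary condition:
`γ_Λ(· | R_S η) = γ_Λ(· | η)`. [folklore] -/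
theorem chainSpecification_momentumReversalOn_of_subset {S Λ : Finset ℤ} (h : S ⊆ Λ) (T : ℝ)
    (η : ChainConfig) :
    P.chainSpecification T Λ (momentumReversalOn S η) = P.chainSpecification T Λ η := by
  simp only [OscillatorChain.chainSpecification, gibbsSpecOfPotential]
  have hg : (fun ζ : Λ → ℝ × ℝ => glueWith Λ ζ (momentumReversalOn S η)) =
      fun ζ : Λ → ℝ × ℝ => glueWith Λ ζ η :=
    funext fun ζ => glueWith_momentumReversalOn_of_subset h ζ η
  rw [hg]

/-- **Every finite-volume Gibbs distribution `γ_Λ(· | η)` is invariant under the reversal of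
momenta inside `Λ`** (`S ⊆ Λ`). [cite: LanfordLebowitzLieb1977, §4 remark (ii)] -/
theorem map_momentumReversalOn_chainSpecification {S Λ : Finset ℤ} (h : S ⊆ Λ) (T : ℝ)
    (η : ChainConfig) :
    (P.chainSpecification T Λ η).map (momentumReversalOn S) = P.chainSpecification T Λ η := by
  rw [← chainSpecification_momentumReversalOn, chainSpecification_momentumReversalOn_of_subset P h]

/-- **Every DLR state of the chain is invariant under every finite partial momentum reversal**
(DLR equation in the volume `S`; LLL 1977 §4 remark (ii): the momenta are centred Gaussian,
independent of everything else). [cite: LanfordLebowitzLieb1977, §4 remark (ii)] -/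
theorem IsChainGibbsMeasure.map_momentumReversalOn {P : OscillatorChain} {T : ℝ}
    {μ : Measure ChainConfig} (hμ : P.IsChainGibbsMeasure T μ) (S : Finset ℤ) :
    μ.map (momentumReversalOn S) = μ := by
  obtain ⟨-, hDLR⟩ := hμ
  refine Measure.ext fun A hA => ?_
  have hA' : MeasurableSet (momentumReversalOn S ⁻¹' A) := measurable_momentumReversalOn S hA
  rw [Measure.map_apply (measurable_momentumReversalOn S) hA, ← hDLR S _ hA', ← hDLR S A hA]
  refine lintegral_congr fun η => ?_
  rw [← Measure.map_apply (measurable_momentumReversalOn S) hA,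
    map_momentumReversalOn_chainSpecification P subset_rfl T η]

/-! ### Static current expectations and covariances of a DLR state -/

/-- **The mean bond current of every DLR state vanishes**, `∫ j_x dμ = 0` (odd under
`R_{{x, x+1}}`; no integrability assumption). [cite: LanfordLebowitzLieb1977, §4 remark (ii)] -/
theorem IsChainGibbsMeasure.integral_bondCurrentZ_eq_zero {P : OscillatorChain} {T : ℝ}
    {μ : Measure ChainConfig} (hμ : P.IsChainGibbsMeasure T μ) (x : ℤ) :
    ∫ σ, P.bondCurrentZ σ x ∂μ = 0 :=
  integral_eq_zero_of_momentumReversalOn_odd (hμ.map_momentumReversalOn {x, x + 1}) fun σ =>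
    P.bondCurrentZ_momentumReversalOn_of_mem σ (by simp) (by simp)

/-- **Static current covariances of a DLR state vanish beyond nearest-neighbour bonds**:
`∫ j_y j_x dμ = 0` whenever `2 ≤ |x - y|`, for EVERY DLR state of EVERY chain at EVERY `T`
(`j_y j_x` is odd under `R_{{y, y+1}}`, which fixes `j_x`; no integrability assumption).
[cite: LanfordLebowitzLieb1977, §4 remark (ii)] -/
theorem IsChainGibbsMeasure.integral_bondCurrentZ_mul_eq_zero {P : OscillatorChain} {T : ℝ}
    {μ : Measure ChainConfig} (hμ : P.IsChainGibbsMeasure T μ) {x y : ℤ} (hxy : 2 ≤ |x - y|) :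
    ∫ σ, P.bondCurrentZ σ y * P.bondCurrentZ σ x ∂μ = 0 := by
  refine integral_eq_zero_of_momentumReversalOn_odd (hμ.map_momentumReversalOn {y, y + 1})
    fun σ => ?_
  have hx : x ∉ ({y, y + 1} : Finset ℤ) := by
    simp only [Finset.mem_insert, Finset.mem_singleton, not_or]
    constructor <;> intro h <;> simp [h] at hxy
  have hx1 : x + 1 ∉ ({y, y + 1} : Finset ℤ) := by
    simp only [Finset.mem_insert, Finset.mem_singleton, not_or]
    refine ⟨fun h => ?_, fun h => ?_⟩
    · have : x - y = -1 := by omega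
      rw [this] at hxy; norm_num at hxy
    · have : x - y = 0 := by omega
      rw [this] at hxy; norm_num at hxy
  rw [P.bondCurrentZ_momentumReversalOn_of_mem σ (by simp) (by simp),
    P.bondCurrentZ_momentumReversalOn_of_not_mem σ hx hx1]
  ring

/-- The static covariances `x ↦ ∫ j_0 j_x dμ` of a DLR state are supported in `{-1, 0, 1}`. [folklore] -/
theorem IsChainGibbsMeasure.integral_bondCurrentZ_mul_eq_zero_of_not_mem {P : OscillatorChain}
    {T : ℝ} {μ : Measure ChainConfig} (hμ : P.IsChainGibbsMeasure T μ) {x : ℤ}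
    (hx : x ∉ ({-1, 0, 1} : Finset ℤ)) :
    ∫ σ, P.bondCurrentZ σ 0 * P.bondCurrentZ σ x ∂μ = 0 := by
  refine hμ.integral_bondCurrentZ_mul_eq_zero ?_
  simp only [Finset.mem_insert, Finset.mem_singleton, not_or] at hx
  rw [sub_zero]
  rcases le_or_gt 0 x with h | h
  · rw [abs_of_nonneg h]; omega
  · rw [abs_of_neg h]; omega

/-- **The summed static covariance of a DLR state always converges absolutely** (it has three
non-zero terms at most): no growth condition on the state is involved. [folklore] -/
theorem IsChainGibbsMeasure.summable_abs_integral_bondCurrentZ_mul {P : OscillatorChain} {T : ℝ}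
    {μ : Measure ChainConfig} (hμ : P.IsChainGibbsMeasure T μ) :
    Summable fun x : ℤ => |∫ σ, P.bondCurrentZ σ 0 * P.bondCurrentZ σ x ∂μ| :=
  summable_of_ne_finset_zero (s := ({-1, 0, 1} : Finset ℤ)) fun x hx => by
    rw [hμ.integral_bondCurrentZ_mul_eq_zero_of_not_mem hx, abs_zero]

/-- The summed static covariance of a DLR state is
`∫ j_0 j_{-1} dμ + ∫ j_0² dμ + ∫ j_0 j_1 dμ`. [folklore] -/
theorem IsChainGibbsMeasure.tsum_integral_bondCurrentZ_mul {P : OscillatorChain} {T : ℝ}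
    {μ : Measure ChainConfig} (hμ : P.IsChainGibbsMeasure T μ) :
    ∑' x : ℤ, ∫ σ, P.bondCurrentZ σ 0 * P.bondCurrentZ σ x ∂μ =
      (∫ σ, P.bondCurrentZ σ 0 * P.bondCurrentZ σ (-1) ∂μ) +
        (∫ σ, P.bondCurrentZ σ 0 * P.bondCurrentZ σ 0 ∂μ) +
          ∫ σ, P.bondCurrentZ σ 0 * P.bondCurrentZ σ 1 ∂μ := by
  rw [tsum_eq_sum (s := ({-1, 0, 1} : Finset ℤ))
    (fun x hx => hμ.integral_bondCurrentZ_mul_eq_zero_of_not_mem hx)]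
  simp [Finset.sum_insert, add_assoc]

end OscillatorChain

/-! ### The time-zero clause of the Green–Kubo witness predicate -/

namespace InfiniteChainDynamics

variable {P : OscillatorChain} (D : InfiniteChainDynamics P)

/-- For a dynamics preserving `μ`, `φ_0 = id` almost everywhere. [folklore] -/
theorem flow_zero_ae_eq {μ : Measure ChainConfig} (hD : D.PreservesMeasure μ) :
    ∀ᵐ σ ∂μ, D.flow 0 σ = σ := by
  filter_upwards [hD.1] with σ hσ using D.flow_zero σ hσ

/-- At `t = 0` the correlation integrands are the static products `j_0 j_x`, a.e. [folklore] -/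
theorem bondCurrentZ_mul_flow_zero_ae_eq {μ : Measure ChainConfig} (hD : D.PreservesMeasure μ)
    (x : ℤ) :
    (fun σ => P.bondCurrentZ σ 0 * P.bondCurrentZ (D.flow 0 σ) x) =ᵐ[μ]
      fun σ => P.bondCurrentZ σ 0 * P.bondCurrentZ σ x := by
  filter_upwards [D.flow_zero_ae_eq hD] with σ hσ
  rw [hσ]

/-- **`C(0)` of a preserved DLR state** is the three-term static sum
`∫ j_0 j_{-1} + ∫ j_0² + ∫ j_0 j_1`. [folklore] -/
theorem currentCorrelation_zero_eq {T : ℝ} {μ : Measure ChainConfig}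
    (hμ : P.IsChainGibbsMeasure T μ) (hD : D.PreservesMeasure μ) :
    D.currentCorrelation μ 0 =
      (∫ σ, P.bondCurrentZ σ 0 * P.bondCurrentZ σ (-1) ∂μ) +
        (∫ σ, P.bondCurrentZ σ 0 * P.bondCurrentZ σ 0 ∂μ) +
          ∫ σ, P.bondCurrentZ σ 0 * P.bondCurrentZ σ 1 ∂μ := by
  rw [← hμ.tsum_integral_bondCurrentZ_mul]
  unfold currentCorrelation
  exact tsum_congr fun x => integral_congr_ae (D.bondCurrentZ_mul_flow_zero_ae_eq hD x)

/-- **The time-zero clause of the Abelian Green–Kubo witness is sitewise integrability only**: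
for a DLR state `μ` preserved by `D`, `D.HasAbsConvergentCorrelation μ 0` holds iff each static
product `j_0 j_x` is `μ`-integrable — the summability half is automatic
(`summable_abs_integral_bondCurrentZ_mul`). In particular it imposes no bound, uniform in `x`, on
the current moments `∫ j_x² dμ`, hence no temperedness of `μ`. [folklore] -/
theorem hasAbsConvergentCorrelation_zero_iff {T : ℝ} {μ : Measure ChainConfig}
    (hμ : P.IsChainGibbsMeasure T μ) (hD : D.PreservesMeasure μ) :
    D.HasAbsConvergentCorrelation μ 0 ↔
      ∀ x : ℤ, Integrable (fun σ => P.bondCurrentZ σ 0 * P.bondCurrentZ σ x) μ := by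
  unfold HasAbsConvergentCorrelation
  have hint : ∀ x : ℤ, Integrable (fun σ => P.bondCurrentZ σ 0 * P.bondCurrentZ (D.flow 0 σ) x) μ ↔
      Integrable (fun σ => P.bondCurrentZ σ 0 * P.bondCurrentZ σ x) μ := fun x =>
    integrable_congr (D.bondCurrentZ_mul_flow_zero_ae_eq hD x)
  have hsum : Summable fun x : ℤ =>
      |∫ σ, P.bondCurrentZ σ 0 * P.bondCurrentZ (D.flow 0 σ) x ∂μ| := by
    refine (hμ.summable_abs_integral_bondCurrentZ_mul).congr fun x => ?_
    rw [integral_congr_ae (D.bondCurrentZ_mul_flow_zero_ae_eq hD x)]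
  constructor
  · rintro ⟨h, -⟩ x
    exact (hint x).1 (h x)
  · intro h
    exact ⟨fun x => (hint x).2 (h x), hsum⟩

end InfiniteChainDynamics

end Literature.MathematicalPhysics.KineticTheory.HeatConduction

end
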